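import Summits.QuantumAdvantage.QuantumAdvantage.Theses.CubicForrelation
import Summits.QuantumAdvantage.QuantumAdvantage.Theorems.CubicForrelationNearExactIsExactDerivDegree
import Summits.QuantumAdvantage.QuantumAdvantage.Theorems.CubicForrelationNearExactIsExactRmWeight
import Summits.QuantumAdvantage.QuantumAdvantage.Theorems.CubicForrelationNearExactIsExactMmFormCeilingA
import Summits.QuantumAdvantage.QuantumAdvantage.Theorems.CubicForrelationNearExactIsExactRankTwoCeilingA
import Literature.Computability.QuantumComplexity.ForrelationDerivativeTables
import Literature.Computability.QuantumComplexity.IQPForrelation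

/-!
# Crux `CubicForrelation.NearExactIsExact` (stmt-QuantumAdvantage-14043) — almost-MM ceiling, part Q:
the algebra of QUADRATIC Boolean functions (polar form, Plücker normal form, Walsh transform)

Line `direct-sum-amplification`, lead c3 (helper file for the registered stub `stub_ammCeiling`).  In the
almost-Maiorana–McFarland branch the slices `c = f(x₁ ‖ ·)` of the cubic `f` are quadratic functions on
`k = a + 2` bits whose POLAR FORM `B(s,t) = c 0 ⊕ c s ⊕ c t ⊕ c (s ⊕ t)` is a symmetric alternating
bilinear form; when it satisfies the Plücker identities on basis vectors and `B(e_p, e_q) = 1` it is the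
rank-two form `row_p ∧ row_q`, the function is the ALIGNED quadratic `(row_p·x)(row_q·x) ⊕ a′·x ⊕ c 0`
(`acq_normalForm`) and its Walsh transform is `± 2^k/2` on the 2-flat `a′ + ⟨row_p, row_q⟩` and `0`
elsewhere (`acq_W_aligned`).  Everything is elementary Boolean algebra over the tree's vocabulary
(`IsDegLeFun`, `bxor`, `twist`, `W`), using the landed stubs D (`stub_derivDegree`) and R (`stub_rmWeight`)
for "degree `0` ⇒ constant" and "degree `1` ⇒ affine".

References: C. Carlet, *Boolean Functions for Cryptography and Coding Theory* (CUP 2021), §2.2 (algebraic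
normal form, derivatives) and §5.1 (quadratic functions and their Walsh spectra); R. O'Donnell, *Analysis of
Boolean Functions* (2014), §1.4.
-/

set_option linter.dupNamespace false -- D-0017: single-problem summit ⇒ `QuantumAdvantage.QuantumAdvantage` by design

noncomputable section

namespace Summit.QuantumAdvantage.QuantumAdvantage.Theorems.CubicForrelation.NearExactIsExact

open Finset
open Literature.Computability.QuantumComplexity
open Literature.Computability.QuantumComplexity.BuzetChailloux (bxor zeroVec signOf_sq bxor_zeroVec zeroVec_bxor
  bxor_comm bxor_self bxor_bxor_cancel_left twist_zeroVec_right twist_bxor_right sum_twist_left bxor_eq_zeroVec_iff)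
open Literature.Computability.QuantumComplexity.DerivativeWalsh (W signOf_not)

variable {k : ℕ}

/-! ### Boolean bookkeeping -/

/-- `signOf` is injective. [folklore] -/
theorem acq_signOf_inj : ∀ a b : Bool, signOf a = signOf b → a = b := by
  intro a b h
  cases a <;> cases b <;> first | rfl | (exfalso; norm_num [signOf] at h)

/-- `x ⊕ y ⊕ y = x` (right cancellation). [folklore] -/
theorem acq_bxor_bxor_cancel_right (x y : Fin k → Bool) : bxor (bxor x y) y = x := by
  rw [bxor_comm (bxor x y), bxor_comm x, bxor_bxor_cancel_left]

/-- Associativity of `⊕` on vectors. [folklore] -/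
theorem acq_bxor_assoc (x y z : Fin k → Bool) : bxor (bxor x y) z = bxor x (bxor y z) := by
  funext i; exact Bool.xor_assoc _ _ _

/-- Degrees add under conjunction (product of representing polynomials). [cite: Carlet2020, §2.2.1 Def. 6] -/
theorem acq_deg_band {a b d : ℕ} {f g : (Fin k → Bool) → Bool} (hf : IsDegLeFun a f) (hg : IsDegLeFun b g)
    (h : a + b ≤ d) : IsDegLeFun d (fun x => f x && g x) := by
  have mul2 : ∀ u v : ZMod 2, decide (u * v = 1) = (decide (u = 1) && decide (v = 1)) := by decide
  obtain ⟨p, hp, hpf⟩ := hf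
  obtain ⟨q, hq, hqg⟩ := hg
  refine ⟨p * q, (MvPolynomial.totalDegree_mul p q).trans ((Nat.add_le_add hp hq).trans h), fun x => ?_⟩
  show (f x && g x) = polyPhase (p * q) x
  rw [hpf, hqg, polyPhase_apply, polyPhase_apply, polyPhase_apply, map_mul]
  exact (mul2 _ _).symm

/-- The constant-in-one-branch selector `fun x => if σ then F x else false` keeps the degree. [folklore] -/
theorem acq_deg_ite {d : ℕ} (σ : Bool) {F : (Fin k → Bool) → Bool} (hF : IsDegLeFun d F) :
    IsDegLeFun d (fun x => if σ then F x else false) := by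
  cases σ
  · exact isDegLeFun_const d false
  · exact hF

/-! ### Degree `0` ⇒ constant; degree `1` ⇒ affine (from the landed stubs D and R) -/

/-- A Boolean function of algebraic degree `≤ 0` is constant. [cite: Carlet2020, §2.2] -/
theorem acq_const_of_deg_zero {F : (Fin k → Bool) → Bool} (hF : IsDegLeFun 0 F) (x : Fin k → Bool) :
    F x = F zeroVec := by
  by_contra hne
  have hG : IsDegLeFun 0 (fun y => F y ^^ F zeroVec) := fc_deg_bxor hF (isDegLeFun_const 0 (F zeroVec))
  have hx : (F x ^^ F zeroVec) = true := by
    revert hne; cases F x <;> cases F zeroVec <;> decide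
  have key := stub_rmWeight stub_derivDegree k 0 (fun y => F y ^^ F zeroVec) hG ⟨x, hx⟩
  have hlt : (univ.filter fun y : Fin k → Bool => (F y ^^ F zeroVec) = true).card < 2 ^ k := by
    have hsub : (univ.filter fun y : Fin k → Bool => (F y ^^ F zeroVec) = true) ⊂ univ := by
      rw [Finset.ssubset_univ_iff]
      intro h
      have h0 : (zeroVec : Fin k → Bool) ∈ univ.filter fun y : Fin k → Bool => (F y ^^ F zeroVec) = true := by
        rw [h]; exact mem_univ _
      rw [mem_filter] at h0
      revert h0; cases F zeroVec <;> simp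
    have := Finset.card_lt_card hsub
    rwa [card_univ, Fintype.card_fun, Fintype.card_bool, Fintype.card_fin] at this
  rw [pow_zero, one_mul] at key
  omega

/-- A Boolean function of algebraic degree `≤ 1` is affine: `F(x ⊕ t) = F x ⊕ F t ⊕ F 0`.
[cite: Carlet2020, §2.2] -/
theorem acq_affine_of_deg_one {F : (Fin k → Bool) → Bool} (hF : IsDegLeFun 1 F) (x t : Fin k → Bool) :
    F (bxor x t) = (F x ^^ F t ^^ F zeroVec) := by
  have hD := acq_const_of_deg_zero (stub_derivDegree k 0 F t hF) x
  simp only [zeroVec_bxor] at hD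
  revert hD
  cases F (bxor x t) <;> cases F x <;> cases F t <;> cases F zeroVec <;> decide

/-! ### The polar form of a quadratic function -/

/-- The second difference of a quadratic `c` at the origin does not depend on the base point:
`c z ⊕ c (z⊕s) ⊕ c (z⊕t) ⊕ c (z⊕s⊕t) = c 0 ⊕ c s ⊕ c t ⊕ c (s⊕t)`. [cite: Carlet2020, §5.1] -/
theorem acq_polar_shift {c : (Fin k → Bool) → Bool} (hc : IsDegLeFun 2 c) (z s t : Fin k → Bool) :
    (c z ^^ c (bxor z s) ^^ c (bxor z t) ^^ c (bxor z (bxor s t))) =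
      (c zeroVec ^^ c s ^^ c t ^^ c (bxor s t)) := by
  have h1 : IsDegLeFun 1 (fun x => c x ^^ c (bxor x s)) := stub_derivDegree k 1 c s hc
  have h0 : IsDegLeFun 0 (fun x => (c x ^^ c (bxor x s)) ^^ (c (bxor x t) ^^ c (bxor (bxor x t) s))) :=
    stub_derivDegree k 0 (fun x => c x ^^ c (bxor x s)) t h1
  have key := acq_const_of_deg_zero h0 z
  simp only [zeroVec_bxor] at key
  rw [acq_bxor_assoc, bxor_comm t s] at key
  revert key
  cases c z <;> cases c (bxor z s) <;> cases c (bxor z t) <;> cases c (bxor z (bxor s t)) <;>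
    cases c zeroVec <;> cases c s <;> cases c t <;> cases c (bxor s t) <;> decide

/-- **Bi-additivity of the polar form**: `B(s, t ⊕ t′) = B(s,t) ⊕ B(s,t′)` for quadratic `c`.
[cite: Carlet2020, §5.1] -/
theorem acq_polar_add {c : (Fin k → Bool) → Bool} (hc : IsDegLeFun 2 c) (s t t' : Fin k → Bool) :
    (c zeroVec ^^ c s ^^ c (bxor t t') ^^ c (bxor s (bxor t t'))) =
      ((c zeroVec ^^ c s ^^ c t ^^ c (bxor s t)) ^^ (c zeroVec ^^ c s ^^ c t' ^^ c (bxor s t'))) := by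
  have key := acq_polar_shift hc t s t'
  rw [bxor_comm t s, show bxor t (bxor s t') = bxor s (bxor t t') from by
    rw [← acq_bxor_assoc, bxor_comm t s, acq_bxor_assoc]] at key
  revert key
  cases c zeroVec <;> cases c s <;> cases c t <;> cases c t' <;> cases c (bxor s t) <;> cases c (bxor t t') <;>
    cases c (bxor s t') <;> cases c (bxor s (bxor t t')) <;> decide

/-! ### Additive Boolean functions are the linear forms -/

/-- An ADDITIVE Boolean function (`L(x ⊕ t) = L x ⊕ L t`) is determined by its values on the unit vectors:
two additive functions agreeing there coincide. [folklore] -/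
theorem acq_additive_ext {L L' : (Fin k → Bool) → Bool} (hL : ∀ x t, L (bxor x t) = (L x ^^ L t))
    (hL' : ∀ x t, L' (bxor x t) = (L' x ^^ L' t)) (he : ∀ i, L (Pi.single i true) = L' (Pi.single i true)) :
    ∀ x, L x = L' x := by
  have h0 : L zeroVec = false := by
    have := hL zeroVec zeroVec
    rw [bxor_self] at this
    revert this; cases L zeroVec <;> decide
  have h0' : L' zeroVec = false := by
    have := hL' zeroVec zeroVec
    rw [bxor_self] at this
    revert this; cases L' zeroVec <;> decide
  have key := fc_const_of_shift (fun x => L x ^^ L' x) (fun i x => by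
    show (L (bxor x (Pi.single i true)) ^^ L' (bxor x (Pi.single i true))) = (L x ^^ L' x)
    rw [hL, hL', he]
    cases L x <;> cases L' x <;> cases L' (Pi.single i true) <;> decide)
  intro x
  have kx := key x
  simp only [h0, h0', Bool.xor_false] at kx
  revert kx; cases L x <;> cases L' x <;> decide

/-! ### Plücker normal form of a quadratic function -/

section NormalForm

variable {c : (Fin k → Bool) → Bool} (l : (Fin k → Bool) → (Fin k → Bool) → Bool)

/-- Abbreviation-free statement of the POLAR ENTRIES `B_{ij} = c 0 ⊕ c e_i ⊕ c e_j ⊕ c (e_i ⊕ e_j)` is used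
inline below; this lemma evaluates the polar form on a unit vector in the second slot through additivity:
`B(s, t) = ⊕_{j : t_j} B(s, e_j)` packaged as "the function `t ↦ B(s,t)` is the linear form of the row". -/
theorem acq_polar_row (hc : IsDegLeFun 2 c) (hl : ∀ y x, signOf (l y x) = twist x y) (s : Fin k → Bool) :
    ∀ t, (c zeroVec ^^ c s ^^ c t ^^ c (bxor s t)) =
      l (fun j => c zeroVec ^^ c s ^^ c (Pi.single j true) ^^ c (bxor s (Pi.single j true))) t := by
  refine acq_additive_ext (fun t t' => acq_polar_add hc s t t') (fc_lin_props (hl _)).1 fun i => ?_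
  rw [(fc_lin_props (hl _)).2.1]

/-- **Plücker normal form.** Let `c` be quadratic on `k` bits with polar entries `B_{ij}`, suppose the Plücker
identities `B_{ij}B_{i′j′} ⊕ B_{ii′}B_{jj′} ⊕ B_{ij′}B_{ji′} = 0` hold for all index quadruples and `B_{pq} = 1`.
With the rows `r_p = (B_{pj})_j`, `r_q = (B_{qj})_j` and `a′_j = c e_j ⊕ c 0 ⊕ B_{pj}B_{qj}`:
`c x = (r_p·x)(r_q·x) ⊕ a′·x ⊕ c 0` for all `x`. [cite: Carlet2020, §5.1] -/
theorem acq_normalForm (hc : IsDegLeFun 2 c) (hl : ∀ y x, signOf (l y x) = twist x y) (p q : Fin k)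
    (hP : ∀ i j i' j' : Fin k,
      (((c zeroVec ^^ c (Pi.single i true) ^^ c (Pi.single j true) ^^ c (bxor (Pi.single i true) (Pi.single j true))) &&
        (c zeroVec ^^ c (Pi.single i' true) ^^ c (Pi.single j' true) ^^ c (bxor (Pi.single i' true) (Pi.single j' true)))) ^^
       ((c zeroVec ^^ c (Pi.single i true) ^^ c (Pi.single i' true) ^^ c (bxor (Pi.single i true) (Pi.single i' true))) &&
        (c zeroVec ^^ c (Pi.single j true) ^^ c (Pi.single j' true) ^^ c (bxor (Pi.single j true) (Pi.single j' true)))) ^^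
       ((c zeroVec ^^ c (Pi.single i true) ^^ c (Pi.single j' true) ^^ c (bxor (Pi.single i true) (Pi.single j' true))) &&
        (c zeroVec ^^ c (Pi.single j true) ^^ c (Pi.single i' true) ^^ c (bxor (Pi.single j true) (Pi.single i' true))))) = false)
    (hpq : (c zeroVec ^^ c (Pi.single p true) ^^ c (Pi.single q true) ^^ c (bxor (Pi.single p true) (Pi.single q true))) = true) :
    ∀ x, c x = ((l (fun j => c zeroVec ^^ c (Pi.single p true) ^^ c (Pi.single j true) ^^ c (bxor (Pi.single p true) (Pi.single j true))) x &&
        l (fun j => c zeroVec ^^ c (Pi.single q true) ^^ c (Pi.single j true) ^^ c (bxor (Pi.single q true) (Pi.single j true))) x) ^^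
      l (fun j => c (Pi.single j true) ^^ c zeroVec ^^
        ((c zeroVec ^^ c (Pi.single p true) ^^ c (Pi.single j true) ^^ c (bxor (Pi.single p true) (Pi.single j true))) &&
         (c zeroVec ^^ c (Pi.single q true) ^^ c (Pi.single j true) ^^ c (bxor (Pi.single q true) (Pi.single j true))))) x ^^
      c zeroVec) := by
  -- notation: polar entries, rows as linear forms
  set B : Fin k → Fin k → Bool := fun i j =>
    c zeroVec ^^ c (Pi.single i true) ^^ c (Pi.single j true) ^^ c (bxor (Pi.single i true) (Pi.single j true)) with hB
  set rp : Fin k → Bool := fun j => B p j with hrp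
  set rq : Fin k → Bool := fun j => B q j with hrq
  have hPl : ∀ i j i' j', ((B i j && B i' j') ^^ (B i i' && B j j') ^^ (B i j' && B j i')) = false := hP
  have hBpq : B p q = true := hpq
  have hBsymm : ∀ i j, B i j = B j i := fun i j => by
    simp only [hB, bxor_comm (Pi.single i true)]
    cases c zeroVec <;> cases c (Pi.single i true) <;> cases c (Pi.single j true) <;>
      cases c (bxor (Pi.single j true) (Pi.single i true)) <;> decide
  have hBdiag : ∀ i, B i i = false := fun i => by
    simp only [hB, bxor_self]
    cases c zeroVec <;> cases c (Pi.single i true) <;> decide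
  -- the rank-two structure on entries: B l t = B l p * B q t + B l q * B p t
  have hEnt : ∀ i j, B i j = ((rp i && rq j) ^^ (rp j && rq i)) := by
    intro i j
    have key := hPl p q i j
    rw [hBpq] at key
    simp only [hrp, hrq]
    revert key
    cases B i j <;> cases B p i <;> cases B q j <;> cases B p j <;> cases B q i <;> decide
  -- linear forms
  have lin := fun y => fc_lin_props (hl y)
  -- the polar form as a function: P s t
  have hPol : ∀ s t, (c zeroVec ^^ c s ^^ c t ^^ c (bxor s t)) = ((l rp s && l rq t) ^^ (l rp t && l rq s)) := by
    -- both sides are additive in t for fixed s and in s for fixed t; compare on unit vectors twice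
    have step1 : ∀ s, (∀ j, (c zeroVec ^^ c s ^^ c (Pi.single j true) ^^ c (bxor s (Pi.single j true))) =
        ((l rp s && rq j) ^^ (rp j && l rq s))) →
        ∀ t, (c zeroVec ^^ c s ^^ c t ^^ c (bxor s t)) = ((l rp s && l rq t) ^^ (l rp t && l rq s)) := by
      intro s hs
      refine acq_additive_ext (fun t t' => acq_polar_add hc s t t') (fun t t' => ?_) (fun j => ?_)
      · rw [(lin rq).1, (lin rp).1]
        cases l rp s <;> cases l rq t <;> cases l rq t' <;> cases l rp t <;> cases l rp t' <;> cases l rq s <;> decide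
      · rw [hs j, (lin rq).2.1, (lin rp).2.1]
    intro s
    apply step1
    intro j
    -- now additivity in s with t = e_j fixed
    have step2 : ∀ s, (c zeroVec ^^ c s ^^ c (Pi.single j true) ^^ c (bxor s (Pi.single j true))) =
        ((l rp s && rq j) ^^ (rp j && l rq s)) := by
      refine acq_additive_ext (fun s s' => ?_) (fun s s' => ?_) (fun i => ?_)
      · have e1 := acq_polar_add hc (Pi.single j true) s s'
        rw [bxor_comm (Pi.single j true) (bxor s s'), bxor_comm (Pi.single j true) s,
          bxor_comm (Pi.single j true) s'] at e1
        revert e1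
        cases c zeroVec <;> cases c (Pi.single j true) <;> cases c s <;> cases c s' <;> cases c (bxor s s') <;>
          cases c (bxor s (Pi.single j true)) <;> cases c (bxor s' (Pi.single j true)) <;>
          cases c (bxor (bxor s s') (Pi.single j true)) <;> decide
      · rw [(lin rp).1, (lin rq).1]
        cases l rp s <;> cases l rp s' <;> cases rq j <;> cases rp j <;> cases l rq s <;> cases l rq s' <;> decide
      · rw [(lin rp).2.1, (lin rq).2.1]
        exact hEnt i j
    exact step2 s
  -- the quadratic part Q x := l rp x && l rq x and the additive remainder
  have hQpol : ∀ s t, (((l rp zeroVec && l rq zeroVec) ^^ (l rp s && l rq s) ^^ (l rp t && l rq t) ^^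
      (l rp (bxor s t) && l rq (bxor s t)))) = ((l rp s && l rq t) ^^ (l rp t && l rq s)) := by
    intro s t
    rw [(lin rp).1, (lin rq).1, (lin rp).2.2, (lin rq).2.2]
    cases l rp s <;> cases l rq t <;> cases l rp t <;> cases l rq s <;> decide
  -- L x := c x ⊕ Q x ⊕ c 0 is additive
  have hLadd : ∀ x t, (c (bxor x t) ^^ (l rp (bxor x t) && l rq (bxor x t)) ^^ c zeroVec) =
      ((c x ^^ (l rp x && l rq x) ^^ c zeroVec) ^^ (c t ^^ (l rp t && l rq t) ^^ c zeroVec)) := by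
    intro x t
    have e1 := hPol x t
    have e2 := hQpol x t
    rw [(lin rp).2.2, (lin rq).2.2] at e2
    revert e1 e2
    cases c zeroVec <;> cases c x <;> cases c t <;> cases c (bxor x t) <;> cases l rp x <;> cases l rq x <;>
      cases l rp t <;> cases l rq t <;> cases l rp (bxor x t) <;> cases l rq (bxor x t) <;> decide
  -- compare L with the linear form of a′
  have hL : ∀ x, (c x ^^ (l rp x && l rq x) ^^ c zeroVec) =
      l (fun j => c (Pi.single j true) ^^ c zeroVec ^^ (B p j && B q j)) x := by
    refine acq_additive_ext hLadd (lin _).1 (fun i => ?_)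
    rw [(lin rp).2.1, (lin rq).2.1, (lin (fun j => c (Pi.single j true) ^^ c zeroVec ^^ (B p j && B q j))).2.1]
    show (c (Pi.single i true) ^^ (B p i && B q i) ^^ c zeroVec) =
      (c (Pi.single i true) ^^ c zeroVec ^^ (B p i && B q i))
    cases c (Pi.single i true) <;> cases B p i <;> cases B q i <;> cases c zeroVec <;> decide
  intro x
  show c x = ((l rp x && l rq x) ^^ l (fun j => c (Pi.single j true) ^^ c zeroVec ^^ (B p j && B q j)) x ^^ c zeroVec)
  have hx := hL x
  generalize l (fun j => c (Pi.single j true) ^^ c zeroVec ^^ (B p j && B q j)) x = la at hx ⊢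
  revert hx
  cases c x <;> cases l rp x <;> cases l rq x <;> cases c zeroVec <;> cases la <;> decide

end NormalForm

/-! ### Aligned quadratics: polar entries, Plücker, Walsh transform -/

section Aligned

variable (l : (Fin k → Bool) → (Fin k → Bool) → Bool)

/-- The rank-two entries `u_i v_j ⊕ u_j v_i` satisfy every Plücker identity. [folklore] -/
theorem acq_pluecker_rank_two (u v : Fin k → Bool) (i j i' j' : Fin k) :
    ((((u i && v j) ^^ (u j && v i)) && ((u i' && v j') ^^ (u j' && v i'))) ^^
      (((u i && v i') ^^ (u i' && v i)) && ((u j && v j') ^^ (u j' && v j))) ^^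
      (((u i && v j') ^^ (u j' && v i)) && ((u j && v i') ^^ (u i' && v j)))) = false := by
  cases u i <;> cases u j <;> cases u i' <;> cases u j' <;> cases v i <;> cases v j <;> cases v i' <;> cases v j' <;>
    decide

/-- Polar entries of the aligned quadratic `(u·x)(v·x) ⊕ a·x ⊕ e`: `B_{ij} = u_i v_j ⊕ u_j v_i`. [cite: Carlet2020, §5.1] -/
theorem acq_polar_aligned (hl : ∀ y x, signOf (l y x) = twist x y) {c : (Fin k → Bool) → Bool}
    {u v a : Fin k → Bool} {e : Bool} (hc : ∀ x, c x = ((l u x && l v x) ^^ l a x ^^ e)) (i j : Fin k) :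
    (c zeroVec ^^ c (Pi.single i true) ^^ c (Pi.single j true) ^^ c (bxor (Pi.single i true) (Pi.single j true))) =
      ((u i && v j) ^^ (u j && v i)) := by
  have lu := fc_lin_props (hl u); have lv := fc_lin_props (hl v); have la := fc_lin_props (hl a)
  rw [hc, hc, hc, hc, lu.1, lv.1, la.1, lu.2.1, lu.2.1, lv.2.1, lv.2.1, la.2.1, la.2.1, lu.2.2, lv.2.2, la.2.2]
  cases u i <;> cases u j <;> cases v i <;> cases v j <;> cases a i <;> cases a j <;> cases e <;> decide

/-- The sign of the aligned quadratic as a combination of four characters: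
`(-1)^{c x} = (-1)^e (-1)^{a·x} (1 + (-1)^{u·x} + (-1)^{v·x} − (-1)^{(u⊕v)·x})/2`. [cite: Carlet2020, §5.1] -/
theorem acq_signOf_aligned (hl : ∀ y x, signOf (l y x) = twist x y) {c : (Fin k → Bool) → Bool}
    {u v a : Fin k → Bool} {e : Bool} (hc : ∀ x, c x = ((l u x && l v x) ^^ l a x ^^ e)) (x : Fin k → Bool) :
    signOf (c x) = signOf e * twist x a * ((1 + twist x u + twist x v - twist x (bxor u v)) / 2) := by
  rw [hc, signOf_xor, signOf_xor, ar_signOf_and, hl, hl, hl, twist_bxor_right]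
  ring

/-- **Walsh transform of the aligned quadratic**: `W(y) = 2^k/2 · (-1)^e ([y=a] + [y=a⊕u] + [y=a⊕v] − [y=a⊕u⊕v])`.
[cite: Carlet2020, §5.1] -/
theorem acq_W_aligned' (hl : ∀ y x, signOf (l y x) = twist x y) {c : (Fin k → Bool) → Bool}
    {u v a : Fin k → Bool} {e : Bool} (hc : ∀ x, c x = ((l u x && l v x) ^^ l a x ^^ e)) (y : Fin k → Bool) :
    W (fun x => signOf (c x)) y = (2 : ℝ) ^ k / 2 * signOf e *
      ((if y = a then 1 else 0) + (if y = bxor a u then 1 else 0) + (if y = bxor a v then 1 else 0) -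
        (if y = bxor a (bxor u v) then 1 else 0)) := by
  unfold W
  have e1 : ∀ x, signOf (c x) * twist x y = signOf e / 2 *
      (twist x (bxor a y) + twist x (bxor (bxor a u) y) + twist x (bxor (bxor a v) y) -
        twist x (bxor (bxor a (bxor u v)) y)) := by
    intro x
    rw [acq_signOf_aligned l hl hc x]
    simp only [twist_bxor_right]
    ring
  rw [sum_congr rfl fun x _ => e1 x, ← mul_sum, sum_sub_distrib, sum_add_distrib, sum_add_distrib,
    sum_twist_left, sum_twist_left, sum_twist_left, sum_twist_left]
  have ind : ∀ z : Fin k → Bool, (if bxor z y = zeroVec then (2 : ℝ) ^ k else 0) =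
      (2 : ℝ) ^ k * (if y = z then 1 else 0) := by
    intro z
    by_cases h : y = z
    · have hz : bxor z y = zeroVec := by rw [h, bxor_self]
      rw [if_pos hz, if_pos h, mul_one]
    · have hz : bxor z y ≠ zeroVec := fun h' => h ((bxor_eq_zeroVec_iff z y).1 h').symm
      rw [if_neg hz, if_neg h, mul_zero]
  rw [ind, ind, ind, ind]
  ring

/-- Walsh transform of an AFFINE function `a·x ⊕ e`: `W(y) = 2^k (-1)^e [y = a]`. [cite: ODonnell2014, §1.4] -/
theorem acq_W_affine (hl : ∀ y x, signOf (l y x) = twist x y) {c : (Fin k → Bool) → Bool}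
    {a : Fin k → Bool} {e : Bool} (hc : ∀ x, c x = (l a x ^^ e)) (y : Fin k → Bool) :
    W (fun x => signOf (c x)) y = (2 : ℝ) ^ k * signOf e * (if y = a then 1 else 0) := by
  unfold W
  have e1 : ∀ x, signOf (c x) * twist x y = signOf e * twist x (bxor a y) := by
    intro x
    rw [hc, signOf_xor, hl, twist_bxor_right]
    ring
  rw [sum_congr rfl fun x _ => e1 x, ← mul_sum, sum_twist_left]
  by_cases h : y = a
  · have hz : bxor a y = zeroVec := by rw [h, bxor_self]
    rw [if_pos hz, if_pos h]; ring
  · have hz : bxor a y ≠ zeroVec := fun h' => h ((bxor_eq_zeroVec_iff a y).1 h').symm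
    rw [if_neg hz, if_neg h]; ring

end Aligned

/-- **Walsh transform of the aligned quadratic** (registered helper-stub form of `acq_W_aligned'`):
`W(y) = 2^k/2 · (-1)^e ([y=a] + [y=a⊕u] + [y=a⊕v] − [y=a⊕u⊕v])` for `c = (u·x)(v·x) ⊕ a·x ⊕ e`.
[cite: Carlet2020, §5.1] -/
theorem acq_W_aligned : ∀ {k : ℕ} (l : (Fin k → Bool) → (Fin k → Bool) → Bool), (∀ y x, signOf (l y x) = twist x y) → ∀ {c : (Fin k → Bool) → Bool} {u v a : Fin k → Bool} {e : Bool}, (∀ x, c x = ((l u x && l v x) ^^ l a x ^^ e)) → ∀ (y : Fin k → Bool), W (fun x => signOf (c x)) y = (2 : ℝ) ^ k / 2 * signOf e * ((if y = a then 1 else 0) + (if y = bxor a u then 1 else 0) + (if y = bxor a v then 1 else 0) - (if y = bxor a (bxor u v) then 1 else 0)) := by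
  intro k l hl c u v a e hc y
  exact acq_W_aligned' l hl hc y

end Summit.QuantumAdvantage.QuantumAdvantage.Theorems.CubicForrelation.NearExactIsExact

end
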